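import Summits.Schanuel.Schanuel.Theorems.ZilberEacDoubleCancellingDensity
import Summits.Schanuel.Schanuel.Theorems.ZilberEacHyperplaneMaster
import Summits.Schanuel.Schanuel.Theorems.ZilberEacComplexHyperplaneDensity
import HarnessLib

/-!
# Real planes in `ℂ³ × (ℂˣ)³`: the family `{x₂ = r₀x₀ + r₁x₁ + c, yⱼ = xⱼ + y₂Fⱼ(y₂)}` is dense
# for ALL `r₀r₁ ≠ 0` with one irrational coefficient — the master theorem, resonant line included

Zilber's Exponential-Algebraic Closedness, case ladder (host summit Schanuel, cell `pub-schanuel`,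
seat 2, gen 15; closes HANDOFF O59 for the targets `Xⱼ`).  THE FAMILY (`F₀, F₁ ∈ ℂ[u] ∖ 0`,
`eⱼ = deg Fⱼ + 1`, `r₀, r₁ ∈ ℝ ∖ 0`, one of them irrational, `c ∈ ℂ`):

  `W = {x₂ = r₀x₀ + r₁x₁ + c,  y₀ = x₀ + y₂F₀(y₂),  y₁ = x₁ + y₂F₁(y₂)} ⊆ ℂ³ × ℂ³`.

`unprojectedDense_polyFibredGraph_hyperplane_offResonance` (this generation) proved
`I(W ∩ Γ_exp) = I(W)` except on the RESONANT MIXED-SIGN LINE `e₀r₀ + e₁r₁ = 1`, `r₀r₁ < 0`,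
`e₀ ≠ e₁`.  On that line `r₁/r₀ ∉ ℚ` automatically (else both `rⱼ` are rational), the degrees
differ, and the DOUBLE-CANCELLING regime (`unprojectedDense_polyFibredGraph_doubleCancelling`, for
the larger-degree fibre in position `0`, or its swap) applies.

* `irrational_ratio_of_resonant` — on the resonant line one irrational `rⱼ` forces `r₁/r₀ ∉ ℚ`.
* `unprojectedDense_polyFibredGraph_doubleCancelling_swap` — the swapped double-cancelling regime.
* **`unprojectedDense_polyFibredGraph_hyperplane_master`** — density for ALL `F₀F₁ ≠ 0`,
  `r₀r₁ ≠ 0`, `r₀ ∉ ℚ ∨ r₁ ∉ ℚ`, `c ∈ ℂ`.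
* `polyFibredGraph_hyperplane_master_member_dense` — with it: all seven hypotheses of `ECCell 3 2`, not
  linearly split, `W ∩ Γ_exp ≠ ∅`, dense.
* **`resonantSqrtTwo_member_dense`** — the resonant mixed-sign member
  `{x₂ = ((1+√2)/2)x₀ − √2x₁, y₀ = x₀ + y₂², y₁ = x₁ + y₂}` (`2r₀ + r₁ = 1`, `e₀ = 2 ≠ 1 = e₁`),
  out of reach of every earlier regime of the cell.
* **`unprojectedDense_polyFibredGraph_plane`** — COMPLEX coefficients: `r₀, r₁ ∈ ℂ ∖ 0`, some `rⱼ ∉ ℚ`,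
  `F₀F₁ ≠ 0`, any `c` ⟹ dense (a non-real coefficient: gen 9's negative lattice ray,
  `unprojectedDense_polyFibredGraph_hyperplaneC`; real coefficients: the master theorem);
  `polyFibredGraph_plane_member_dense`.

HONEST FRAMING: one explicit 3-fold family inside the OPEN cell `EC(3,2)` (what stays open for it:
vanishing coefficients `r₀r₁ = 0` in some ranges, a zero fibre polynomial in some sign ranges, both
`rⱼ` rational — where freeness itself can fail); `EC(3,2)` OPEN; NOT Schanuel's conjecture; EAC ⇏ SC.
-/

noncomputable section

open Complex MvPolynomial Filter Topology
open Literature.NumberTheory.Transcendental Literature.ModelTheory.Zilber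
  Literature.ModelTheory.ExponentialFields

set_option linter.dupNamespace false

namespace Summit.Schanuel.Schanuel.Theorems

section Master

/-- **On the resonant line the ratio is irrational.**  If `e₀r₀ + e₁r₁ = 1` with naturals
`e₀, e₁`, `r₀ ≠ 0` and one of `r₀, r₁` is irrational, then `r₁/r₀ ∉ ℚ`. [folklore] -/
theorem irrational_ratio_of_resonant {e₀ e₁ : ℕ} {r₀ r₁ : ℝ} (hr₀ : r₀ ≠ 0)
    (hirr : Irrational r₀ ∨ Irrational r₁) (hS : (e₀ : ℝ) * r₀ + (e₁ : ℝ) * r₁ = 1) :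
    Irrational (r₁ / r₀) := by
  rintro ⟨q, hq⟩
  have hr₁q : r₁ = (q : ℝ) * r₀ := by rw [hq, div_mul_cancel₀ r₁ hr₀]
  have h1 : r₀ * ((e₀ : ℝ) + (e₁ : ℝ) * q) = 1 := by
    rw [hr₁q] at hS
    linear_combination hS
  have hD : (e₀ : ℝ) + (e₁ : ℝ) * q ≠ 0 := by
    intro h0
    rw [h0, mul_zero] at h1
    exact zero_ne_one h1
  have hr₀q : r₀ = 1 / ((e₀ : ℝ) + (e₁ : ℝ) * q) := by
    field_simp
    linear_combination h1
  rcases hirr with h | h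
  · exact h ⟨1 / ((e₀ : ℚ) + (e₁ : ℚ) * q), by push_cast; exact hr₀q.symm⟩
  · exact h ⟨q / ((e₀ : ℚ) + (e₁ : ℚ) * q), by push_cast; rw [hr₁q, hr₀q]; field_simp⟩

/-- **The swapped double-cancelling regime**: `deg F₀ < deg F₁`, `r₀r₁ < 0`, `r₀/r₁ ∉ ℚ` ⟹ dense
(coordinate swap `0 ↔ 1`, `polyFibredGraph_hyperplane_swap`). (new) -/
theorem unprojectedDense_polyFibredGraph_doubleCancelling_swap (F : Fin 2 → Polynomial ℂ)
    (hF0 : F 0 ≠ 0) (hF1 : F 1 ≠ 0) (hdeg : (F 0).natDegree < (F 1).natDegree)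
    (r₀ r₁ : ℝ) (hsign : r₀ * r₁ < 0) (hirr : Irrational (r₀ / r₁)) (c : ℂ) :
    UnprojectedDense (polyFibredGraph (hyperplanePoly ![r₀, r₁] c) (fun j => X j)
      (fun j => (F j).toMvPolynomial 0)) := by
  have h := unprojectedDense_polyFibredGraph_doubleCancelling (F ∘ Equiv.swap (0 : Fin 2) 1)
    (by simpa using hF1) (by simpa using hF0) (by simpa using hdeg) r₁ r₀ (by rwa [mul_comm]) hirr c
  rw [← unprojectedDense_compPerm_iff (Equiv.swap (0 : Fin 3) 1), polyFibredGraph_hyperplane_swap] at h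
  exact h

/-- **THE MASTER THEOREM for real planes with targets `Xⱼ`.**  `F₀F₁ ≠ 0`, `r₀r₁ ≠ 0`, one of
`r₀, r₁` irrational, any `c` ⟹ `I(W ∩ Γ_exp) = I(W)` for
`W = {x₂ = r₀x₀ + r₁x₁ + c, y₀ = x₀ + y₂F₀(y₂), y₁ = x₁ + y₂F₁(y₂)}`.  Off the resonant mixed-sign
line: `unprojectedDense_polyFibredGraph_hyperplane_offResonance`; on it: the double-cancelling
regime. (new) [cite: MantovaMasser2023, §1 p.5 (the open case dim π(V) = 2 in ℂ³×ℂˣ³)] -/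
theorem unprojectedDense_polyFibredGraph_hyperplane_master (F : Fin 2 → Polynomial ℂ)
    (hF0 : F 0 ≠ 0) (hF1 : F 1 ≠ 0) (r₀ r₁ : ℝ) (hr₀ : r₀ ≠ 0) (hr₁ : r₁ ≠ 0)
    (hirr : Irrational r₀ ∨ Irrational r₁) (c : ℂ) :
    UnprojectedDense (polyFibredGraph (hyperplanePoly ![r₀, r₁] c) (fun j => X j)
      (fun j => (F j).toMvPolynomial 0)) := by
  by_cases hres : (((F 0).natDegree + 1 : ℕ) : ℝ) * r₀ + (((F 1).natDegree + 1 : ℕ) : ℝ) * r₁ = 1 →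
      r₀ * r₁ < 0 → (F 0).natDegree = (F 1).natDegree
  · exact unprojectedDense_polyFibredGraph_hyperplane_offResonance F hF0 hF1 r₀ r₁ hr₀ hr₁ hirr c hres
  -- the resonant mixed-sign line with unequal degrees
  simp only [Classical.not_imp] at hres
  obtain ⟨hS, hsign, hdeg⟩ := hres
  have hq : Irrational (r₁ / r₀) := irrational_ratio_of_resonant hr₀ hirr hS
  rcases lt_or_gt_of_ne hdeg with h | h
  · have hq' : Irrational (r₀ / r₁) := by
      have := hq.inv
      rwa [inv_div] at this
    exact unprojectedDense_polyFibredGraph_doubleCancelling_swap F hF0 hF1 h r₀ r₁ hsign hq' c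
  · exact unprojectedDense_polyFibredGraph_doubleCancelling F hF0 hF1 h r₀ r₁ hsign hq c

/-- **Cell membership and density, all real planes with `r₀r₁ ≠ 0`**: `F₀F₁ ≠ 0`, one `rⱼ`
irrational, any `c` ⟹ all seven hypotheses of `ECCell 3 2`, not linearly split, `W ∩ Γ_exp ≠ ∅`,
`I(W ∩ Γ_exp) = I(W)`. (new) [cite: MantovaMasser2023, §1 p.5 (the open case dim π(V) = 2 in ℂ³×ℂˣ³)] -/
theorem polyFibredGraph_hyperplane_master_member_dense (F : Fin 2 → Polynomial ℂ)
    (hF0 : F 0 ≠ 0) (hF1 : F 1 ≠ 0) (r₀ r₁ : ℝ) (hr₀ : r₀ ≠ 0) (hr₁ : r₁ ≠ 0)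
    (hirr : Irrational r₀ ∨ Irrational r₁) (c : ℂ) :
    (IsIrreducibleClosed ℂ (polyFibredGraph (hyperplanePoly ![r₀, r₁] c) (fun j => X j)
        (fun j => (F j).toMvPolynomial 0)) ∧
      (polyFibredGraph (hyperplanePoly ![r₀, r₁] c) (fun j => X j) (fun j => (F j).toMvPolynomial 0) ∩
          torusLocus ℂ 3).Nonempty ∧
      IsRotund ℂ 3 (polyFibredGraph (hyperplanePoly ![r₀, r₁] c) (fun j => X j)
          (fun j => (F j).toMvPolynomial 0) ∩ torusLocus ℂ 3) ∧
      IsAddFree ℂ 3 (polyFibredGraph (hyperplanePoly ![r₀, r₁] c) (fun j => X j)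
          (fun j => (F j).toMvPolynomial 0) ∩ torusLocus ℂ 3) ∧
      IsMulFree ℂ 3 (polyFibredGraph (hyperplanePoly ![r₀, r₁] c) (fun j => X j)
          (fun j => (F j).toMvPolynomial 0) ∩ torusLocus ℂ 3) ∧
      zariskiDim ℂ (polyFibredGraph (hyperplanePoly ![r₀, r₁] c) (fun j => X j)
          (fun j => (F j).toMvPolynomial 0)) = (3 : ℕ) ∧
      addProjDim ℂ 3 (polyFibredGraph (hyperplanePoly ![r₀, r₁] c) (fun j => X j)
          (fun j => (F j).toMvPolynomial 0)) = (2 : ℕ)) ∧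
    ¬ IsLinearSplit ℂ 3 (polyFibredGraph (hyperplanePoly ![r₀, r₁] c) (fun j => X j)
        (fun j => (F j).toMvPolynomial 0)) ∧
    (polyFibredGraph (hyperplanePoly ![r₀, r₁] c) (fun j => X j) (fun j => (F j).toMvPolynomial 0) ∩
        expGraph ℂ 3).Nonempty ∧
    UnprojectedDense (polyFibredGraph (hyperplanePoly ![r₀, r₁] c) (fun j => X j)
        (fun j => (F j).toMvPolynomial 0)) := by
  have hA : Function.Injective (aeval (fun j : Fin 2 => (X j : MvPolynomial (Fin 2) ℂ)) :
      MvPolynomial (Fin 2) ℂ →ₐ[ℂ] MvPolynomial (Fin 2) ℂ) := by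
    rw [aeval_X_left]; exact fun _ _ h => h
  have hirr' : ∃ i : Fin 2, Irrational ((![r₀, r₁] : Fin 2 → ℝ) i) := by
    rcases hirr with h | h
    · exact ⟨0, by simpa using h⟩
    · exact ⟨1, by simpa using h⟩
  have hcell := ecCell_hypotheses_polyFibredGraph_hyperplane ![r₀, r₁] c (fun j => X j)
    (fun j => (F j).toMvPolynomial 0) hA hirr'
  have hdense := unprojectedDense_polyFibredGraph_hyperplane_master F hF0 hF1 r₀ r₁ hr₀ hr₁ hirr c
  refine ⟨hcell, not_isLinearSplit_polyFibredGraph _ (fun j => X j) _ (by norm_num) hA, ?_, hdense⟩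
  obtain ⟨w, hw, -⟩ := hcell.2.1
  exact inter_expGraph_nonempty_of_vanishingIdeal_eq ⟨w, hw⟩ hdense

/-- **The resonant mixed-sign member, dense**:
`W = {x₂ = ((1+√2)/2)x₀ − √2x₁, y₀ = x₀ + y₂², y₁ = x₁ + y₂}` (`e₀ = 2`, `e₁ = 1`,
`e₀r₀ + e₁r₁ = 1`, `r₀r₁ < 0`: the one line no earlier regime of the cell reached): all seven
hypotheses of `ECCell 3 2`, not linearly split, `W ∩ Γ_exp ≠ ∅`, `I(W ∩ Γ_exp) = I(W)`. (new)
[cite: MantovaMasser2023, §1 p.5 (the open case dim π(V) = 2 in ℂ³×ℂˣ³)] -/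
theorem resonantSqrtTwo_member_dense :
    let F : Fin 2 → Polynomial ℂ := ![Polynomial.X, 1]
    let W := polyFibredGraph (hyperplanePoly ![(1 + Real.sqrt 2) / 2, -Real.sqrt 2] 0) (fun j => X j)
      (fun j => (F j).toMvPolynomial 0)
    (IsIrreducibleClosed ℂ W ∧ (W ∩ torusLocus ℂ 3).Nonempty ∧ IsRotund ℂ 3 (W ∩ torusLocus ℂ 3) ∧
        IsAddFree ℂ 3 (W ∩ torusLocus ℂ 3) ∧ IsMulFree ℂ 3 (W ∩ torusLocus ℂ 3) ∧
        zariskiDim ℂ W = (3 : ℕ) ∧ addProjDim ℂ 3 W = (2 : ℕ)) ∧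
      ¬ IsLinearSplit ℂ 3 W ∧ (W ∩ expGraph ℂ 3).Nonempty ∧ UnprojectedDense W := by
  have h2 : 0 < Real.sqrt 2 := Real.sqrt_pos.2 two_pos
  exact polyFibredGraph_hyperplane_master_member_dense ![Polynomial.X, 1] (by simp) (by simp)
    ((1 + Real.sqrt 2) / 2) (-Real.sqrt 2) (by positivity) (by linarith)
    (Or.inr irrational_sqrt_two.neg) 0

end Master

section Plane

/-- **Two nonzero integers with `am + bn > 0`** whenever `a ≠ 0`. [folklore] -/
theorem exists_int_pair_pos (a b : ℝ) (ha : a ≠ 0) :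
    ∃ m n : ℤ, m ≠ 0 ∧ n ≠ 0 ∧ 0 < a * m + b * n := by
  obtain ⟨N, hN⟩ := exists_nat_gt (|b| / |a|)
  have hapos : 0 < |a| := abs_pos.2 ha
  have hkey : |b| < |a| * N := by
    rw [div_lt_iff₀ hapos] at hN
    linarith
  have hNpos : 0 < N := by
    rcases Nat.eq_zero_or_pos N with h | h
    · rw [h, Nat.cast_zero, mul_zero] at hkey
      linarith [abs_nonneg b]
    · exact h
  rcases lt_or_gt_of_ne ha with hneg | hpos
  · refine ⟨-(N : ℤ), 1, by omega, one_ne_zero, ?_⟩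
    push_cast
    rw [abs_of_neg hneg] at hkey
    nlinarith [neg_abs_le b]
  · refine ⟨(N : ℤ), 1, by omega, one_ne_zero, ?_⟩
    push_cast
    rw [abs_of_pos hpos] at hkey
    nlinarith [neg_abs_le b]

/-- **A lattice direction positive against the imaginary parts**: if some `Im rᵢ ≠ 0` there is
`q₀ ∈ (ℤ ∖ 0)²` with `Σ Im(rᵢ)q₀ᵢ > 0`. [folklore] -/
theorem exists_latticeDir_of_im_ne_zero (r : Fin 2 → ℂ) (h : ∃ i, (r i).im ≠ 0) :
    ∃ q₀ : Fin 2 → ℤ, (∀ j, q₀ j ≠ 0) ∧ 0 < ∑ i, (r i).im * (q₀ i : ℝ) := by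
  rcases Fin.exists_fin_two.1 h with h0 | h1
  · obtain ⟨m, n, hm, hn, hpos⟩ := exists_int_pair_pos (r 0).im (r 1).im h0
    refine ⟨![m, n], fun j => ?_, ?_⟩
    · fin_cases j
      · simpa using hm
      · simpa using hn
    · rw [Fin.sum_univ_two]
      simpa using hpos
  · obtain ⟨m, n, hm, hn, hpos⟩ := exists_int_pair_pos (r 1).im (r 0).im h1
    refine ⟨![n, m], fun j => ?_, ?_⟩
    · fin_cases j
      · simpa using hn
      · simpa using hm
    · rw [Fin.sum_univ_two]
      simp only [Matrix.cons_val_zero, Matrix.cons_val_one]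
      linarith

/-- **THE PLANE THEOREM (complex coefficients).**  `F₀F₁ ≠ 0`, `r₀, r₁ ∈ ℂ ∖ 0`, some `rⱼ ∉ ℚ`,
any `c` ⟹ `I(W ∩ Γ_exp) = I(W)` for `W = {x₂ = r₀x₀ + r₁x₁ + c, yⱼ = xⱼ + y₂Fⱼ(y₂)}`.  A non-real
coefficient: the negative lattice ray of `unprojectedDense_polyFibredGraph_hyperplaneC`
(`exists_latticeDir_of_im_ne_zero`); real coefficients: `unprojectedDense_polyFibredGraph_hyperplane_master`.
(new) [cite: MantovaMasser2023, §1 p.5 (the open case dim π(V) = 2 in ℂ³×ℂˣ³)] -/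
theorem unprojectedDense_polyFibredGraph_plane (F : Fin 2 → Polynomial ℂ) (hF0 : F 0 ≠ 0)
    (hF1 : F 1 ≠ 0) (r : Fin 2 → ℂ) (hr : ∀ i, r i ≠ 0) (hirr : ∃ i, ∀ ρ : ℚ, r i ≠ (ρ : ℂ))
    (c : ℂ) :
    UnprojectedDense (polyFibredGraph (∑ i, C (r i) * X i + C c) (fun j => X j)
      (fun j => (F j).toMvPolynomial 0)) := by
  classical
  by_cases him : ∃ i, (r i).im ≠ 0
  · obtain ⟨q₀, hq₀0, hq₀⟩ := exists_latticeDir_of_im_ne_zero r him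
    exact unprojectedDense_polyFibredGraph_hyperplaneC r c q₀ hq₀0 hq₀ (fun j => X j)
      (fun j => X_ne_zero j) _
  have him' : ∀ i, (r i).im = 0 := fun i => by
    by_contra h
    exact him ⟨i, h⟩
  set rr : Fin 2 → ℝ := fun i => (r i).re with hrr
  have hr_eq : ∀ i, r i = ((rr i : ℝ) : ℂ) := fun i =>
    Complex.ext (by simp [hrr]) (by simp [hrr, him' i])
  have hW : (∑ i, C (r i) * X i + C c : MvPolynomial (Fin 2) ℂ) = hyperplanePoly ![rr 0, rr 1] c := by
    rw [hyperplanePoly, Fin.sum_univ_two, Fin.sum_univ_two]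
    simp only [Matrix.cons_val_zero, Matrix.cons_val_one]
    rw [hr_eq 0, hr_eq 1]
  rw [hW]
  have hirr_of : ∀ i, (∀ ρ : ℚ, r i ≠ (ρ : ℂ)) → Irrational (rr i) := by
    rintro i hi ⟨ρ, hρ⟩
    exact hi ρ (by rw [hr_eq i, ← hρ]; norm_cast)
  have hirr' : Irrational (rr 0) ∨ Irrational (rr 1) := by
    rcases Fin.exists_fin_two.1 hirr with h | h
    · exact Or.inl (hirr_of 0 h)
    · exact Or.inr (hirr_of 1 h)
  have hne : ∀ i, rr i ≠ 0 := fun i h0 => hr i (by rw [hr_eq i, h0, Complex.ofReal_zero])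
  exact unprojectedDense_polyFibredGraph_hyperplane_master F hF0 hF1 (rr 0) (rr 1) (hne 0) (hne 1)
    hirr' c

/-- **Cell membership and density for every complex plane**: `F₀F₁ ≠ 0`, `r₀r₁ ≠ 0`, some
`rⱼ ∉ ℚ`, any `c` ⟹ all seven hypotheses of `ECCell 3 2`, not linearly split, `W ∩ Γ_exp ≠ ∅`,
`I(W ∩ Γ_exp) = I(W)`. (new) [cite: MantovaMasser2023, §1 p.5 (the open case dim π(V) = 2 in ℂ³×ℂˣ³)] -/
theorem polyFibredGraph_plane_member_dense (F : Fin 2 → Polynomial ℂ) (hF0 : F 0 ≠ 0)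
    (hF1 : F 1 ≠ 0) (r : Fin 2 → ℂ) (hr : ∀ i, r i ≠ 0) (hirr : ∃ i, ∀ ρ : ℚ, r i ≠ (ρ : ℂ))
    (c : ℂ) :
    (IsIrreducibleClosed ℂ (polyFibredGraph (∑ i, C (r i) * X i + C c) (fun j => X j)
        (fun j => (F j).toMvPolynomial 0)) ∧
      (polyFibredGraph (∑ i, C (r i) * X i + C c) (fun j => X j) (fun j => (F j).toMvPolynomial 0) ∩
          torusLocus ℂ 3).Nonempty ∧
      IsRotund ℂ 3 (polyFibredGraph (∑ i, C (r i) * X i + C c) (fun j => X j)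
          (fun j => (F j).toMvPolynomial 0) ∩ torusLocus ℂ 3) ∧
      IsAddFree ℂ 3 (polyFibredGraph (∑ i, C (r i) * X i + C c) (fun j => X j)
          (fun j => (F j).toMvPolynomial 0) ∩ torusLocus ℂ 3) ∧
      IsMulFree ℂ 3 (polyFibredGraph (∑ i, C (r i) * X i + C c) (fun j => X j)
          (fun j => (F j).toMvPolynomial 0) ∩ torusLocus ℂ 3) ∧
      zariskiDim ℂ (polyFibredGraph (∑ i, C (r i) * X i + C c) (fun j => X j)
          (fun j => (F j).toMvPolynomial 0)) = (3 : ℕ) ∧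
      addProjDim ℂ 3 (polyFibredGraph (∑ i, C (r i) * X i + C c) (fun j => X j)
          (fun j => (F j).toMvPolynomial 0)) = (2 : ℕ)) ∧
    ¬ IsLinearSplit ℂ 3 (polyFibredGraph (∑ i, C (r i) * X i + C c) (fun j => X j)
        (fun j => (F j).toMvPolynomial 0)) ∧
    (polyFibredGraph (∑ i, C (r i) * X i + C c) (fun j => X j) (fun j => (F j).toMvPolynomial 0) ∩
        expGraph ℂ 3).Nonempty ∧
    UnprojectedDense (polyFibredGraph (∑ i, C (r i) * X i + C c) (fun j => X j)
        (fun j => (F j).toMvPolynomial 0)) := by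
  have hA : Function.Injective (aeval (fun j : Fin 2 => (X j : MvPolynomial (Fin 2) ℂ)) :
      MvPolynomial (Fin 2) ℂ →ₐ[ℂ] MvPolynomial (Fin 2) ℂ) := by
    rw [aeval_X_left]; exact fun _ _ h => h
  have hcell := ecCell_hypotheses_polyFibredGraph_hyperplaneC r c (fun j => X j)
    (fun j => (F j).toMvPolynomial 0) hA hirr
  have hdense := unprojectedDense_polyFibredGraph_plane F hF0 hF1 r hr hirr c
  refine ⟨hcell, not_isLinearSplit_polyFibredGraph _ (fun j => X j) _ (by norm_num) hA, ?_, hdense⟩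
  obtain ⟨w, hw, -⟩ := hcell.2.1
  exact inter_expGraph_nonempty_of_vanishingIdeal_eq ⟨w, hw⟩ hdense

end Plane

end Summit.Schanuel.Schanuel.Theorems
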